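/-
Origin: expansion seat `planner-pub-hodgecm-pv11-g9-0`, handover TWO rewrites: `^import Pv11g9\.` -> `import HodgeCM.PerL34.` (x1: PrintedSmoothEndState, my row #6 r30 2fd0602c) and `^import Pv02g7\.` -> `import HodgeCM.Automorphic.` (x1: WeilThetaModelDeriv, pv02-g7 #4 r30 d10137d0) ; after HodgeCM/PerL34/PrintedSmoothEndState.lean (pv11-g9 #6) AND HodgeCM/Automorphic/WeilThetaModelDeriv.lean (pv02-g7 #4); HOLD iff either is held (`HOME/pub-hodgecm-pv11-g9/lean/Pv11g9/PrintedSmoothEndStateDeriv.lean`, md5 32c8624a, 139 lines);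
landed by the gen-8 packager in gate run 30 as `HodgeCM/PerL34/PrintedSmoothEndStateDeriv.lean` (import ^import Pv02g7\.WeilThetaModelDeriv[ \t]*$→import HodgeCM.Automorphic.WeilThetaModelDeriv ×1; import ^import Pv11g9\.PrintedSmoothEndState[ \t]*$→import HodgeCM.PerL34.PrintedSmoothEndState ×1).
-/
/-
Copyright: pub-hodgecm cell, unit pub-hodgecm-pv11-g9 (DAG-NODE PROVER #11, gen 9), node #7. Mathlib + tree only.
Origin / target: `HOME/pub-hodgecm-pv11-g9/lean/Pv11g9/PrintedSmoothEndStateDeriv.lean` →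
`HodgeCM/PerL34/PrintedSmoothEndStateDeriv.lean` (imports this seat's node #6 `Pv11g9.PrintedSmoothEndState` → tree
`HodgeCM.PerL34.PrintedSmoothEndState`, rewrite `^import Pv11g9\.` ↦ `import HodgeCM.PerL34.`; and pv02-g7's RUN-30 leaf
`Pv02g7.WeilThetaModelDeriv` → tree `HodgeCM.Automorphic.WeilThetaModelDeriv`, rewrite `^import Pv02g7\.` ↦
`import HodgeCM.Automorphic.`).
-/
import Summits.HodgeConjecture.HodgeCM.PerL34.PrintedSmoothEndState_2
import Summits.HodgeConjecture.HodgeCM.Automorphic.WeilThetaModelDeriv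

/-!
# The END-STATE `smooth` clause in pv02-g7's vocabulary (`WeilThetaModel.HasSKDerivAt`), by name

The seam between the pv11 end-state S4 input (node #6 `LinSmoothSide.smooth`, the 𝒯-free derivative field) and the
pv02 lane's model-level notion of differentiability IN 𝒮^κ (`WeilThetaModel.HasSKDerivAt γ γ' s₀ :=
Tendsto (slope γ s₀) (𝓝[≠] s₀) (𝓝 γ')`, RUN-30 leaf `WeilThetaModelDeriv`).  On the END STATE
`T∘ := ThetaModel.ofRegCarrier (C.rtc R12 R34) hA` of a core `C : U.AdelicTorusCore hP` with LINEAR Weil theta models: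

* §1 DICTIONARY (`rfl`): `(T∘.core V c).omg = (C.wm V c).omg` — the core's ω IS the Weil theta model's ω.
* §1 `tendsto_coe_smul_iff_hasSKDerivAt` — the `smooth` clause of a curve in `T∘.SK V c = ↥(C.wm V c).SK` is LITERALLY
  `(C.wm V c).HasSKDerivAt γ γ' 0` (pv02-g7 `hasSKDerivAt_zero_iff_tendsto_coe_smul`); `smooth_clause_of_hasSKDerivAt`
  is the form a discharger uses to fill the field `LinSmoothSide.smooth` from a model-level derivative.
* §2 CROSS-CHECK, TWO KERNEL ROUTES TO `hF`: node #5's theta-side derivative `hF` on the end state follows from a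
  model-level `HasSKDerivAt` EITHER through node #6 (`smooth ⇒ hF` via the linearity laws and operator-norm continuity of
  Φ ↦ 𝒯_Φ) OR directly by pv02-g7's §5 `WeilThetaModel.hasDerivAt_comp_opTC_θ_orbit ν (P.evalPt p) e Φ Ψ` through node
  #2's `rfl` dictionary `𝒯_Φ = opTC (θ_Φ) ν` — `hasDerivAt_pointFunctional_of_hasSKDerivAt` (pv02 route) and
  `hasDerivAt_pointFunctional_of_hasSKDerivAt'` (node-#6 route) have the SAME statement.

HONEST LABEL.  Pure glue (two `Iff`s, one `rfl`, two routes to one statement); no new S4 content; nothing archimedean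
proved.  Its point is by-name interoperability: a constructed linear Weil theta model that proves
`M.HasSKDerivAt (fun s => M.omg (e_j s) (φ⊗Φ_f)) ((X_jφ)⊗Φ_f) 0` (pv14 / pv09 / pv13 / pv05 lanes, [SETUP D5′]) fills the
end-state field `smooth` by `smooth_clause_of_hasSKDerivAt`, with no statement about the theta kernel.
-/

set_option autoImplicit false

noncomputable section

open scoped Topology
open Filter MeasureTheory

namespace HodgeCM

namespace Universe

namespace AdelicTorusCore

open HodgeCM.PerL34 HodgeCM.PerL34.ArchC
open HodgeCM.Prior.Perl34File HodgeCM.Prior.Perl34File.Perl34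
open NumberField

variable {U : Universe} {hP : PrintFact_unitaryCompact} (C : U.AdelicTorusCore hP)
  (R12 : ∀ {L : CMField} {ι₁ : L →+* ℂ} (V : HermSpace3 L ι₁) (c : SeesawCtx L), C.Rest12 V c)
  (R34 : ∀ {L : CMField} {ι₁ : L →+* ℂ} (V : HermSpace3 L ι₁) (c : SeesawCtx L), C.Rest34 V c)
  (hA : (C.rtc R12 R34).Analytic)

section Deriv

variable {L : CMField} {ι₁ : L →+* ℂ} (V : HermSpace3 L ι₁) (c : SeesawCtx L)

/-! ## §1  The dictionary and the `Iff` -/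

/-- **DICTIONARY (`rfl`)**: the END-STATE core's Weil-representation action IS the Weil theta model's `ω`. -/
theorem core_omg_eq_wm_omg :
    ((ThetaModel.ofRegCarrier (C.rtc R12 R34) hA).core V c).omg = (C.wm V c).omg := rfl

/-- **The `smooth` clause IS pv02-g7's `HasSKDerivAt` at 0** on the end state of a linear Weil theta model: for a curve
`γ` in `T∘.SK V c = ↥(C.wm V c).SK`, convergence of `((s : ℝ) : ℂ)⁻¹ • (γ s − γ 0)` to `γ'` in 𝒮^κ (node #6's form,
pv06-g6's form) ↔ `(C.wm V c).HasSKDerivAt γ γ' 0` (pv02-g7 `hasSKDerivAt_zero_iff_tendsto_coe_smul`). -/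
theorem tendsto_coe_smul_iff_hasSKDerivAt [ℓ : (C.wm V c).LinearStr]
    (γ : ℝ → (ThetaModel.ofRegCarrier (C.rtc R12 R34) hA).SK V c)
    (γ' : (ThetaModel.ofRegCarrier (C.rtc R12 R34) hA).SK V c) :
    Tendsto (fun s : ℝ => ((s : ℝ) : ℂ)⁻¹ • (γ s - γ 0)) (𝓝[≠] 0) (𝓝 γ') ↔ (C.wm V c).HasSKDerivAt γ γ' 0 :=
  (WeilThetaModel.hasSKDerivAt_zero_iff_tendsto_coe_smul (M := C.wm V c)).symm

/-- **Filling `LinSmoothSide.smooth` from a model-level derivative**: if the ω-orbit `s ↦ ω(e s)Φ` of `Φ ∈ 𝒮^κ` has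
derivative `Ψ` at 0 IN 𝒮^κ in pv02-g7's sense, then the end-state `smooth` clause holds for the curve
`s ↦ (T∘.core V c).omg (e s) Φ` with limit `Ψ` (ω of the core = ω of the model, §1 dictionary). -/
theorem smooth_clause_of_hasSKDerivAt [ℓ : (C.wm V c).LinearStr]
    (e : ℝ → (ThetaModel.ofRegCarrier (C.rtc R12 R34) hA).G V c)
    (Φ Ψ : (ThetaModel.ofRegCarrier (C.rtc R12 R34) hA).SK V c)
    (h : (C.wm V c).HasSKDerivAt (fun s => (C.wm V c).omg (e s) Φ) Ψ 0) :
    Tendsto (fun s : ℝ => ((s : ℝ) : ℂ)⁻¹ •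
        (((ThetaModel.ofRegCarrier (C.rtc R12 R34) hA).core V c).omg (e s) Φ -
          ((ThetaModel.ofRegCarrier (C.rtc R12 R34) hA).core V c).omg (e 0) Φ)) (𝓝[≠] 0) (𝓝 Ψ) :=
  (C.tendsto_coe_smul_iff_hasSKDerivAt R12 R34 hA V c (fun s => (C.wm V c).omg (e s) Φ) Ψ).2 h

/-- … and conversely: the end-state `smooth` clause gives the model-level derivative. -/
theorem hasSKDerivAt_of_smooth_clause [ℓ : (C.wm V c).LinearStr]
    (e : ℝ → (ThetaModel.ofRegCarrier (C.rtc R12 R34) hA).G V c)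
    (Φ Ψ : (ThetaModel.ofRegCarrier (C.rtc R12 R34) hA).SK V c)
    (h : Tendsto (fun s : ℝ => ((s : ℝ) : ℂ)⁻¹ •
        (((ThetaModel.ofRegCarrier (C.rtc R12 R34) hA).core V c).omg (e s) Φ -
          ((ThetaModel.ofRegCarrier (C.rtc R12 R34) hA).core V c).omg (e 0) Φ)) (𝓝[≠] 0) (𝓝 Ψ)) :
    (C.wm V c).HasSKDerivAt (fun s => (C.wm V c).omg (e s) Φ) Ψ 0 :=
  (C.tendsto_coe_smul_iff_hasSKDerivAt R12 R34 hA V c (fun s => (C.wm V c).omg (e s) Φ) Ψ).1 h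

/-! ## §2  Two kernel routes from `HasSKDerivAt` to node #5's `hF` -/

/-- **Route pv02 (by name)**: the theta-side operator-norm derivative `hF` of node #5 at a point `p` of any pointed
structure over the end-state core, from the model-level derivative, by pv02-g7's
`WeilThetaModel.hasDerivAt_comp_opTC_θ_orbit ν (P.evalPt p) e Φ Ψ` through node #2's `rfl` dictionary
`𝒯_Φ = opTC (θ_Φ) ν`, `𝒯_Φ(·)(p) = (evalPt p) ∘L 𝒯_Φ`. -/
theorem hasDerivAt_pointFunctional_of_hasSKDerivAt [ℓ : (C.wm V c).LinearStr]
    (P : C4a.PointedCore ((ThetaModel.ofRegCarrier (C.rtc R12 R34) hA).core V c))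
    (e : ℝ → (ThetaModel.ofRegCarrier (C.rtc R12 R34) hA).G V c)
    (Φ Ψ : (ThetaModel.ofRegCarrier (C.rtc R12 R34) hA).SK V c)
    (h : (C.wm V c).HasSKDerivAt (fun s => (C.wm V c).omg (e s) Φ) Ψ 0) (p : P.Pt) :
    HasDerivAt
      (fun s : ℝ => C4a.pointFunctional ((ThetaModel.ofRegCarrier (C.rtc R12 R34) hA).core V c) P
        (((ThetaModel.ofRegCarrier (C.rtc R12 R34) hA).core V c).omg (e s) Φ) p)
      (C4a.pointFunctional ((ThetaModel.ofRegCarrier (C.rtc R12 R34) hA).core V c) P Ψ p) 0 :=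
  (C.wm V c).hasDerivAt_comp_opTC_θ_orbit (c.D.latticeModelW hP).toQuotientModel.ν (P.evalPt p) e Φ Ψ h

/-- **Route node #6**: the same statement through `smooth ⇒ hF` (node #6 `hasDerivAt_pointFunctional_of_tendsto_slope`
with node #4 `TΦc_add_of_linear` / `TΦc_smul_of_linear` and node #3 `continuous_TΦc`). -/
theorem hasDerivAt_pointFunctional_of_hasSKDerivAt' [ℓ : (C.wm V c).LinearStr]
    (P : C4a.PointedCore ((ThetaModel.ofRegCarrier (C.rtc R12 R34) hA).core V c))
    (e : ℝ → (ThetaModel.ofRegCarrier (C.rtc R12 R34) hA).G V c)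
    (Φ Ψ : (ThetaModel.ofRegCarrier (C.rtc R12 R34) hA).SK V c)
    (h : (C.wm V c).HasSKDerivAt (fun s => (C.wm V c).omg (e s) Φ) Ψ 0) (p : P.Pt) :
    HasDerivAt
      (fun s : ℝ => C4a.pointFunctional ((ThetaModel.ofRegCarrier (C.rtc R12 R34) hA).core V c) P
        (((ThetaModel.ofRegCarrier (C.rtc R12 R34) hA).core V c).omg (e s) Φ) p)
      (C4a.pointFunctional ((ThetaModel.ofRegCarrier (C.rtc R12 R34) hA).core V c) P Ψ p) 0 :=
  hasDerivAt_pointFunctional_of_tendsto_slope (C.TΦc_add_of_linear R12 R34 hA V c)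
    (C.TΦc_smul_of_linear R12 R34 hA V c) (C.continuous_TΦc R12 R34 hA V c)
    (C.smooth_clause_of_hasSKDerivAt R12 R34 hA V c e Φ Ψ h) p

end Deriv

end AdelicTorusCore

end Universe

end HodgeCM

end
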